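import Mathlib
import HarnessLib
import Summits.Ventures.LatticeQCDFlow.Scoring.KernelTransitionOperator
import Summits.Ventures.LatticeQCDFlow.Scoring.CalibrationTruths

/-!
# The autocorrelation envelope of a Markov kernel minorised by its own invariant law
# (general state space): `|C_f(t)| ≤ (1 − ε)ᵗ · Var_π f`, `τ_int(f) ≤ 1/ε − 1/2`

HONEST FRAMING: exact (Metropolis-corrected) sampling algorithms for lattice gauge theory;
figures of merit are autocorrelation/cost numbers at stated couplings and volumes; no
continuum-physics claim.

Venture `LatticeQCDFlow` (cell pub-lqcd), topic `Scoring`; FANOUT row 8 (`s0-cpn-nemc`, GEN-10).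
NEW WORK of the cell, not a published result: the general-state-space form of the finite-state
envelope `Scoring/IMHAutocorrelationEnvelope.lean` (`twoTime_abs_le_of_minorized`,
`tauInt_le_of_minorized`), over Mathlib's `ProbabilityTheory.Kernel` / `Kernel.Invariant` and the
groundwork of `Scoring/KernelTransitionOperator.lean` (`kop`, `autocov`, the residual-kernel action
on centred observables, Jensen, Cauchy–Schwarz).  Published input: only the residual kernel of the
tree's formalisation of Doeblin's theorem (`Literature.Probability.MarkovChains.DoeblinMinorization`,
Meyn–Tweedie 1993 Thm 16.2.4) through its splitting; the theorem's own total-variation conclusion is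
NOT used — the envelope below has the constant `Var_π f`, not `‖f‖_∞²`.

## Content (`κ` a Markov kernel, `π` an invariant probability law, DOEBLIN BY THE INVARIANT LAW
## ITSELF: `κ(x, B) ≥ ε π(B)` for all `x` and measurable `B`; `f` bounded measurable, `π(f) = 0`)

* `integral_sq_iterate_kop_le` — `∫ ((kop R)^[t] g)² dπ ≤ ∫ g² dπ` for any Markov `R` leaving `π`
  invariant; `eps_le_one_of_doeblin`, `one_sub_toReal_nonneg_of_doeblin`, `autocov_zero`.
* **`abs_autocov_le_of_doeblin`** — THE ENVELOPE: `|∫ f · (kop κ)^[t] f dπ| ≤ (1 − ε)ᵗ · ∫ f² dπ`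
  (constant ONE in front of the variance; no reversibility, no spectral theory; `ε = 1` included).
* `abs_acf_le_of_doeblin` — `|ρ_t| ≤ (1 − ε)ᵗ`; **`tauInt_le_of_doeblin`** — on the tree's
  `Scoring.tauInt`: `τ_int(f) ≤ 1/ε − 1/2` for every bounded measurable centred observable (`ε > 0`).
* **`tauInt_le_exp_of_doeblin`**, `abs_acf_le_exp_of_doeblin` — the same with `ε = e^{−M}`:
  `τ_int(f) ≤ e^{M} − 1/2`, `|ρ_t| ≤ (1 − e^{−M})ᵗ`.  This is exactly the hypothesis shape delivered
  by the tree's exact flow-MCMC theorems (`Exactness/ApproxTrivializingSampler.lean`: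
  `indepMH_exact_doeblin_of_density_ratio` (iii) — a model/target density-ratio oscillation `≤ M`
  gives `K(x,·) ≥ e^{−M} π`; `flowSampler_exact_doeblin` — a flow-equation defect `δ` gives
  `M = 2δ`); the instantiation is the companion file `Scoring/FlowSamplerAutocorrelation.lean`.
So, read with those theorems: EVERY bounded observable of the exact flow-MCMC sampler built on a
flow with log-weight oscillation `M` has `|ρ_t| ≤ (1 − e^{−M})ᵗ` and `τ_int ≤ e^{M} − 1/2`, at every
volume at which the oscillation bound holds (the bound `M` itself is volume-dependent in general —
theory-1's `TrivializingMaps/*` quantify how).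
-/


noncomputable section

namespace Summit.Ventures.LatticeQCDFlow.Scoring

open MeasureTheory ProbabilityTheory Filter Literature.Probability.MarkovChains
open scoped ENNReal

variable {Ω : Type*} [MeasurableSpace Ω]

/-! ### The envelope -/

section Envelope

variable {κ : Kernel Ω Ω} [IsMarkovKernel κ] {π : Measure Ω} [IsProbabilityMeasure π] {ε : ℝ≥0∞}

/-- `∫ ((kop η)^[t] g)² dπ ≤ ∫ g² dπ` for a Markov kernel `η` leaving `π` invariant (pointwise Jensen,
then invariance on `g²`). -/
theorem integral_sq_iterate_kop_le (η : Kernel Ω Ω) [IsMarkovKernel η] (hη : Kernel.Invariant η π)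
    {g : Ω → ℝ} (hg : Measurable g) {C : ℝ} (hC : ∀ x, |g x| ≤ C) :
    ∀ t : ℕ, ∫ x, ((kop η)^[t] g x) ^ 2 ∂π ≤ ∫ x, g x ^ 2 ∂π := by
  intro t
  induction t with
  | zero => exact le_rfl
  | succ t ih =>
    obtain ⟨hm, hb⟩ := iterate_kop_bounded_measurable η hg hC t
    have hpt : ∀ x, (kop η ((kop η)^[t] g) x) ^ 2 ≤ kop η (fun y => ((kop η)^[t] g y) ^ 2) x :=
      fun x => sq_integral_le_integral_sq (η x) hm hb
    have hu2m : Measurable (fun y => ((kop η)^[t] g y) ^ 2) := hm.pow_const 2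
    have hu2b : ∀ y, |((kop η)^[t] g y) ^ 2| ≤ C ^ 2 := fun y => by
      rw [abs_pow]; exact pow_le_pow_left₀ (abs_nonneg _) (hb y) 2
    calc ∫ x, ((kop η)^[t + 1] g x) ^ 2 ∂π = ∫ x, (kop η ((kop η)^[t] g) x) ^ 2 ∂π := by
          rw [Function.iterate_succ_apply']
      _ ≤ ∫ x, kop η (fun y => ((kop η)^[t] g y) ^ 2) x ∂π := by
          refine integral_mono ?_ ?_ fun x => hpt x
          · exact integrable_of_bounded π ((measurable_kop η hm).pow_const 2) (C := C ^ 2)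
              fun x => by
                rw [abs_pow]; exact pow_le_pow_left₀ (abs_nonneg _) (abs_kop_le η hb x) 2
          · exact integrable_of_bounded π (measurable_kop η hu2m) (abs_kop_le η hu2b)
      _ = ∫ x, ((kop η)^[t] g x) ^ 2 ∂π := integral_kop η hη hu2m hu2b
      _ ≤ ∫ x, g x ^ 2 ∂π := ih

/-- Under a minorisation `κ(x, ·) ≥ ε π` by a probability law, `ε ≤ 1`. -/
theorem eps_le_one_of_doeblin (hmin : ∀ x {B : Set Ω}, MeasurableSet B → ε * π B ≤ κ x B) :
    ε ≤ 1 := by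
  obtain ⟨x0⟩ := nonempty_of_isProbabilityMeasure π
  have h := hmin x0 MeasurableSet.univ
  rwa [measure_univ, measure_univ, mul_one] at h

/-- … hence `0 ≤ 1 − ε.toReal` (and `ε.toReal ≤ 1`). -/
theorem one_sub_toReal_nonneg_of_doeblin
    (hmin : ∀ x {B : Set Ω}, MeasurableSet B → ε * π B ≤ κ x B) : 0 ≤ 1 - ε.toReal := by
  have h := ENNReal.toReal_mono ENNReal.one_ne_top (eps_le_one_of_doeblin hmin)
  rw [ENNReal.toReal_one] at h
  linarith

/-- `autocov κ π f 0 = ∫ f² dπ`. -/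
theorem autocov_zero (κ : Kernel Ω Ω) (π : Measure Ω) (f : Ω → ℝ) :
    autocov κ π f 0 = ∫ x, f x ^ 2 ∂π := by
  show ∫ x, f x * f x ∂π = _
  exact integral_congr_ae (ae_of_all _ fun x => by ring)

/-- **THE AUTOCORRELATION ENVELOPE (general state space).**  If `π` is an invariant probability law
of the Markov kernel `κ` and `κ(x, B) ≥ ε π(B)` for every state `x` and measurable `B` (Doeblin by
the invariant law itself), then for every bounded measurable `π`-centred observable `f` and every
`t`: `|∫ f · (kop κ)^[t] f dπ| ≤ (1 − ε)ᵗ · ∫ f² dπ` — constant one, no reversibility. -/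
theorem abs_autocov_le_of_doeblin (hπ : Kernel.Invariant κ π)
    (hmin : ∀ x {B : Set Ω}, MeasurableSet B → ε * π B ≤ κ x B) {f : Ω → ℝ} (hf : Measurable f)
    {C : ℝ} (hC : ∀ x, |f x| ≤ C) (hf0 : ∫ x, f x ∂π = 0) (t : ℕ) :
    |autocov κ π f t| ≤ (1 - ε.toReal) ^ t * ∫ x, f x ^ 2 ∂π := by
  have hε1 : ε ≤ 1 := eps_le_one_of_doeblin hmin
  have hf2 : 0 ≤ ∫ x, f x ^ 2 ∂π := integral_nonneg fun x => sq_nonneg _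
  rcases eq_or_lt_of_le hε1 with h1 | hε
  · -- `ε = 1`: `κ x = π` for every `x`, a centred observable is killed in one step
    subst h1
    have hKπ : ∀ x, κ x = π := fun x => by
      ext B hB
      refine le_antisymm ?_ (by simpa using hmin x hB)
      have hc : π Bᶜ ≤ κ x Bᶜ := by simpa using hmin x hB.compl
      rw [prob_compl_eq_one_sub hB, prob_compl_eq_one_sub hB] at hc
      exact (ENNReal.sub_le_sub_iff_left prob_le_one ENNReal.one_ne_top).1 hc
    have hkf : kop κ f = fun _ => 0 := by
      funext x
      unfold kop
      rw [hKπ x, hf0]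
    cases t with
    | zero =>
      rw [pow_zero, one_mul, autocov_zero, abs_of_nonneg hf2]
    | succ t =>
      have hzero : ∀ s : ℕ, (kop κ)^[s] (fun _ : Ω => (0 : ℝ)) = fun _ => 0 := by
        intro s
        induction s with
        | zero => rfl
        | succ s ih =>
          rw [Function.iterate_succ_apply', ih]
          funext x
          simp [kop]
      have hz : (kop κ)^[t + 1] f = fun _ => 0 := by
        rw [Function.iterate_succ_apply, hkf, hzero]
      simp only [autocov, hz, mul_zero, integral_zero, abs_zero]
      rw [ENNReal.toReal_one, sub_self, zero_pow (Nat.succ_ne_zero t), zero_mul]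
  · -- `ε < 1`: the residual kernel carries `f`
    haveI := Doeblin.isMarkovKernel_residualKernel (κ := κ) (ν := π) (hmin := hmin) hε
    have hR := iterate_kop_eq_of_centred (hmin := hmin) hπ hε hf hC hf0 t
    obtain ⟨hum, hub⟩ :=
      iterate_kop_bounded_measurable (Doeblin.residualKernel κ π ε hmin) hf hC t
    have hcs := sq_integral_mul_le π hf hum hC hub
    have hu2 := integral_sq_iterate_kop_le (Doeblin.residualKernel κ π ε hmin)
      (invariant_residualKernel hπ hε) hf hC t
    have hfu : |∫ x, f x * (kop (Doeblin.residualKernel κ π ε hmin))^[t] f x ∂π|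
        ≤ ∫ x, f x ^ 2 ∂π := by
      refine abs_le_of_sq_le_sq ?_ hf2
      calc (∫ x, f x * (kop (Doeblin.residualKernel κ π ε hmin))^[t] f x ∂π) ^ 2
          ≤ (∫ x, f x ^ 2 ∂π) *
              ∫ x, ((kop (Doeblin.residualKernel κ π ε hmin))^[t] f x) ^ 2 ∂π := hcs
        _ ≤ (∫ x, f x ^ 2 ∂π) * ∫ x, f x ^ 2 ∂π := mul_le_mul_of_nonneg_left hu2 hf2
        _ = (∫ x, f x ^ 2 ∂π) ^ 2 := by ring
    have hεr : (1 - ε).toReal = 1 - ε.toReal := by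
      rw [ENNReal.toReal_sub_of_le hε1 ENNReal.one_ne_top, ENNReal.toReal_one]
    have hc0 : 0 ≤ 1 - ε.toReal := one_sub_toReal_nonneg_of_doeblin hmin
    have hauto : autocov κ π f t
        = (1 - ε.toReal) ^ t * ∫ x, f x * (kop (Doeblin.residualKernel κ π ε hmin))^[t] f x ∂π := by
      unfold autocov
      rw [hR, ← integral_const_mul]
      refine integral_congr_ae (ae_of_all _ fun x => ?_)
      show f x * ((1 - ε).toReal ^ t * (kop (Doeblin.residualKernel κ π ε hmin))^[t] f x) = _
      rw [hεr]
      ring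
    rw [hauto, abs_mul, abs_of_nonneg (pow_nonneg hc0 t)]
    exact mul_le_mul_of_nonneg_left hfu (pow_nonneg hc0 t)

/-- In `ρ` form: `|C_f(t) / C_f(0)| ≤ (1 − ε)ᵗ` (trivial when `Var_π f = 0`, Lean's `x/0 = 0`). -/
theorem abs_acf_le_of_doeblin (hπ : Kernel.Invariant κ π)
    (hmin : ∀ x {B : Set Ω}, MeasurableSet B → ε * π B ≤ κ x B) {f : Ω → ℝ} (hf : Measurable f)
    {C : ℝ} (hC : ∀ x, |f x| ≤ C) (hf0 : ∫ x, f x ∂π = 0) (t : ℕ) :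
    |autocov κ π f t / autocov κ π f 0| ≤ (1 - ε.toReal) ^ t := by
  have h := abs_autocov_le_of_doeblin hπ hmin hf hC hf0 t
  have hc0 := one_sub_toReal_nonneg_of_doeblin hmin
  rw [autocov_zero]
  rcases (integral_nonneg fun x => sq_nonneg (f x) : 0 ≤ ∫ x, f x ^ 2 ∂π).eq_or_lt with hz | hpos
  · rw [← hz, div_zero, abs_zero]
    exact pow_nonneg hc0 t
  · rw [abs_div, abs_of_pos hpos, div_le_iff₀ hpos]
    exact h

/-- **`τ_int(f) ≤ 1/ε − 1/2`** on the tree's `Scoring.tauInt` (`= 1/2 + Σ_{t ≥ 1} ρ_t`), for every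
bounded measurable `π`-centred observable of a Markov kernel with invariant probability law `π` and
`κ(x, ·) ≥ ε π`, `ε > 0` (the autocorrelation series converges absolutely by the envelope). -/
theorem tauInt_le_of_doeblin (hπ : Kernel.Invariant κ π)
    (hmin : ∀ x {B : Set Ω}, MeasurableSet B → ε * π B ≤ κ x B) (hε0 : 0 < ε) {f : Ω → ℝ}
    (hf : Measurable f) {C : ℝ} (hC : ∀ x, |f x| ≤ C) (hf0 : ∫ x, f x ∂π = 0) :
    tauInt (fun t => autocov κ π f t / autocov κ π f 0) ≤ 1 / ε.toReal - 1 / 2 := by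
  have henv := fun t => abs_acf_le_of_doeblin hπ hmin hf hC hf0 t
  have hε1 := eps_le_one_of_doeblin hmin
  have hεr0 : 0 < ε.toReal :=
    ENNReal.toReal_pos hε0.ne' (ne_top_of_le_ne_top ENNReal.one_ne_top hε1)
  have hl0 : 0 ≤ 1 - ε.toReal := one_sub_toReal_nonneg_of_doeblin hmin
  have hl1 : 1 - ε.toReal < 1 := by linarith
  have habs : |1 - ε.toReal| < 1 := by rw [abs_of_nonneg hl0]; exact hl1
  have hgeo := hasSum_geometric_succ habs
  have hsum : Summable fun t : ℕ => autocov κ π f (t + 1) / autocov κ π f 0 :=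
    Summable.of_norm_bounded hgeo.summable fun t => by
      rw [Real.norm_eq_abs]; exact henv (t + 1)
  have hle : ∑' t : ℕ, autocov κ π f (t + 1) / autocov κ π f 0
      ≤ (1 - ε.toReal) / (1 - (1 - ε.toReal)) := by
    rw [← hgeo.tsum_eq]
    exact Summable.tsum_le_tsum (fun t => (le_abs_self _).trans (henv (t + 1))) hsum hgeo.summable
  unfold tauInt
  have hε' : (1 - ε.toReal) / (1 - (1 - ε.toReal)) = 1 / ε.toReal - 1 := by
    rw [sub_sub_cancel, sub_div, div_self hεr0.ne']
  linarith [hle, hε']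

/-- **`τ_int(f) ≤ e^{M} − 1/2`** — the same with the Doeblin constant written `e^{−M}`, the shape in
which the tree's exact flow-MCMC theorems deliver it (`Exactness/ApproxTrivializingSampler.lean`:
log-weight oscillation `M`, or `M = 2δ` for a flow-equation defect `δ`). -/
theorem tauInt_le_exp_of_doeblin (hπ : Kernel.Invariant κ π) {M : ℝ}
    (hmin : ∀ x {B : Set Ω}, MeasurableSet B → ENNReal.ofReal (Real.exp (-M)) * π B ≤ κ x B)
    {f : Ω → ℝ} (hf : Measurable f) {C : ℝ} (hC : ∀ x, |f x| ≤ C) (hf0 : ∫ x, f x ∂π = 0) :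
    tauInt (fun t => autocov κ π f t / autocov κ π f 0) ≤ Real.exp M - 1 / 2 := by
  have h := tauInt_le_of_doeblin hπ hmin (ENNReal.ofReal_pos.2 (Real.exp_pos _)) hf hC hf0
  have h1 : 1 / (ENNReal.ofReal (Real.exp (-M))).toReal = Real.exp M := by
    rw [ENNReal.toReal_ofReal (Real.exp_pos _).le, Real.exp_neg, one_div, inv_inv]
  rw [h1] at h
  exact h

/-- … and the envelope in that shape: `|ρ_t| ≤ (1 − e^{−M})ᵗ`. -/
theorem abs_acf_le_exp_of_doeblin (hπ : Kernel.Invariant κ π) {M : ℝ}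
    (hmin : ∀ x {B : Set Ω}, MeasurableSet B → ENNReal.ofReal (Real.exp (-M)) * π B ≤ κ x B)
    {f : Ω → ℝ} (hf : Measurable f) {C : ℝ} (hC : ∀ x, |f x| ≤ C) (hf0 : ∫ x, f x ∂π = 0)
    (t : ℕ) : |autocov κ π f t / autocov κ π f 0| ≤ (1 - Real.exp (-M)) ^ t := by
  have h := abs_acf_le_of_doeblin hπ hmin hf hC hf0 t
  rwa [ENNReal.toReal_ofReal (Real.exp_pos _).le] at h

end Envelope

end Summit.Ventures.LatticeQCDFlow.Scoring

end
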